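import Summits.BirchSwinnertonDyer.BirchSwinnertonDyer.Theorems.ByReductionTypeAtTwoOrdRedClassKit
import Summits.BirchSwinnertonDyer.Rank1Residual.X5.KatoOrdTwoTowerGapIff
import HarnessLib

/-!
# Route ByReductionTypeAtTwo, cruxes `OrdKatoHalfAtTwoIso` (19573) / `OrdKatoHalfAtTwo` (19271): the seat's SECOND typed
# target `X5.O1.TowerGapAtTwo` on the `E[2]`-REDUCIBLE good-ordinary block — MEMO-7 (4.3) «T-ord-2 per class» as a
# kernel door: Kato half AT the member (ORD-RED, MEMO-7 Cor. D2) + the certificate `μ_an = 0` ⇒ `X(E/ℚ_∞)` torsion with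
# `μ = 0` ⇒ `TowerGapAtTwo W`, WITHOUT a layer-count certificate (seat `bsd-2adic-ord` GEN 11)

HONEST FRAMING (cell `bsd-2adic`, run/shared/lean/pub/bsd-2adic/, HUMAN RULINGS D-0036 / D-0054 / D-0074): THEOREMS ONLY;
nothing asserted; nothing booked; BSD is not proved by any of this. PARTITION: X5@2 good-ord `E[2]`-reducible sub-block
(B1·O1) × `p = 2` — types-the-object-of (the tree target `X5.O1.TowerGapAtTwo W` = «`Sel(E/ℚ_∞)₂` cotorsion with
`μ_E = 0`», `KatoOrdTwoTowerGapIff`); closes none. TIER (planner RC-135 (4)): MEMO — the booked currency of the T4 / T5 /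
GVI-T rows stays the two-engine LAYER certificates; this door changes no road and is not an offer input. It records, in
the kernel, that on the reducible locus Greenberg's «conjecturally `μ_E = m_E`» (LNM 1716 p. 170) in the Kato direction
(MEMO-7 Cor. D2: `μ(X(E/ℚ_∞)) ≤ μ(ϖ_E·L₂(f,α))` at every member) turns the finite certificate `μ_an(E) = 0`
(`AnalyticMuLE W 2 0`: one coefficient of `ϖ_E·L₂(f,α)` is a `2`-adic unit) into `μ(X(E/ℚ_∞)) = 0`.

* `towerGapAtTwo_of_mainConjectureLowerDivisibilityAtTwoOrd_of_analyticMuLE` — pure bookkeeping, any image: modularity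
  (to name the newform and the period ratio `ϖ`), Kato 17.4 (1) at `2` (`X` torsion), the Kato half AT `W`
  (`O1.MainConjectureLowerDivisibilityAtTwoOrd W`: `ϖ·L₂ = ι g`, `g ∈ char_Λ X`) and `AnalyticMuLE W 2 0` (`μ(g) = 0`)
  give `μ(X) = μ(f_X) ≤ μ(g) = 0` for every cyclotomic datum, i.e. `TowerGapAtTwo W`.
* `towerGapAtTwo_ordRed_of_analyticMuLE` — on the ORD-RED road: binder `hB7` + PUB/PRINT by name + RECORD `hr` + KERNEL
  {`¬ CM`, `GoodOrd W 2`, rational `2`-torsion abscissa} + CERT `hμan : AnalyticMuLE W 2 0` ⇒ `TowerGapAtTwo W`.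
* `towerGapAtTwo_and_mainConjectureLowerDivisibilityAtTwoOrd_ordRed_of_analyticMuLE` — BOTH typed targets of the
  seat's brief at such a member (the analogue, on the whole reducible locus at analytic rank `0`, of the α-go door
  `O1.towerGapAtTwo_and_mainConjectureLowerDivisibilityAtTwoOrd_of_prop514`, with Greenberg Prop. 5.14 replaced by
  {MEMO-7 binder, `μ_an = 0`}).
References: [GreenbergLNM1716] Thm. 4.1, p. 170, §1 Conj. 1.11; [Kato2004Asterisque] Thm. 17.4 (1)(2);
[GreenbergVatsal2000] p. 2 (2); [Washington1997] §13.2.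
-/

set_option autoImplicit false
-- the sub-problem namespace repeats the summit name by design (D-0017 nested layout)
set_option linter.dupNamespace false

noncomputable section

open scoped Classical MatrixGroups ModularForm

open CongruenceSubgroup WeierstrassCurve Literature.NumberTheory.EllipticCurves
  Literature.NumberTheory.EllipticCurves.ModularForms
  Literature.NumberTheory.EllipticCurves.Rank1Residual
  Literature.NumberTheory.EllipticCurves.Rank1Residual.Typed
  Literature.NumberTheory.EllipticCurves.Greenberg1999
  Summit.BirchSwinnertonDyer.Rank1Residual.X1.MuLambda
  Summit.BirchSwinnertonDyer.Rank1Residual.X1.MuPart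
  Summit.BirchSwinnertonDyer.Rank1Residual.X5 Summit.BirchSwinnertonDyer.Rank1Residual.X5.O1
  Summit.BirchSwinnertonDyer.Rank1Residual.X5.Instances
  Summit.BirchSwinnertonDyer.BirchSwinnertonDyer.Theorems.OrdKatoIntAtTwo
  Summit.BirchSwinnertonDyer.BirchSwinnertonDyer.Theorems.OrdKatoOptimalAtTwo

namespace Summit.BirchSwinnertonDyer.BirchSwinnertonDyer.Theorems.OrdRedAtTwo

variable (W : WeierstrassCurve ℚ) [W.IsElliptic] [W.IsGloballyMinimal]

/-- **Kato half AT `W` + `μ_an(W) = 0` ⇒ `TowerGapAtTwo W`** (any residual image; pure bookkeeping). For every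
cyclotomic datum `D`: `X = D.X` is torsion (Kato 17.4 (1) at `2`, `h17`, read at the newform `f_E` that modularity `hmod`
names, with its rational period ratio `ϖ`); the Kato half gives `g ∈ char_Λ X = (f_X)` with `ι g = ϖ·L₂(f,α)`; the
certificate `AnalyticMuLE W 2 0` gives a coefficient of `ι g` of norm `> 2⁻¹`, so `μ(g) = 0`, hence
`μ(X) = μ(f_X) ≤ μ(g) = 0` (`f_X ∣ g`). Then `towerGapAtTwo_iff_isTorsion_and_mu_eq_zero`.
[cite: Kato2004Asterisque, Thm. 17.4 (1) (p. 273)] [cite: GreenbergVatsal2000, p. 2, (2)] [cite: Washington1997, §13.2] -/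
theorem towerGapAtTwo_of_mainConjectureLowerDivisibilityAtTwoOrd_of_analyticMuLE
    (hmod : nonempty_modularParametrizationData)
    (h17 : ∀ [NeZero (W.conductorNorm ℤ)] (f : CuspForm (Gamma0 (W.conductorNorm ℤ)) 2),
      kato_divisibility_allPrimes W 2 (f := f))
    (hgo : GoodOrd W 2) (hK : O1.MainConjectureLowerDivisibilityAtTwoOrd W) (hμan : AnalyticMuLE W 2 0) :
    TowerGapAtTwo W := by
  refine (towerGapAtTwo_iff_isTorsion_and_mu_eq_zero W).mpr fun κ γ hκ hγ hγ' D => ?_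
  have hord : IsOrdinaryAt W 2 := hgo
  haveI : NeZero (W.conductorNorm ℤ) := ⟨(W.conductorNorm_pos_holds).ne'⟩
  haveI : Module.Finite (IwasawaAlgebra 2) D.X := D.module_finite_holds hγ
  obtain ⟨Dm⟩ := hmod W
  obtain ⟨ϖ, -, hϖ, -⟩ := Dm.exists_rat_mul_realPeriodRat_eq_plusPeriod
  have hD : D.IsTorsion := (h17 Dm.f κ γ hκ hγ hγ' hord Dm.isNewformOf D).1
  obtain ⟨g, hg, hιg⟩ := hK κ γ hκ hγ hγ' hord Dm.f Dm.isNewformOf ϖ hϖ D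
  obtain ⟨k, hk⟩ := hμan Dm.f Dm.isNewformOf ϖ hϖ
  rw [← hιg] at hk
  have hμg : mu g ≤ 0 := mu_le_of_lt_norm_coeff hk
  have hg0 : g ≠ 0 := by
    rintro rfl
    rw [map_zero, map_zero, norm_zero] at hk
    exact not_le.mpr hk (by positivity)
  obtain ⟨fX, hfX⟩ := (charIdeal_isPrincipal_holds 2 D.X).principal
  have hchar : D.charIdeal = Ideal.span {fX} := hfX
  rw [hchar] at hg
  obtain ⟨c, hc⟩ := Ideal.mem_span_singleton'.mp hg
  have hfX0 : fX ≠ 0 := by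
    rintro rfl
    exact hg0 (by rw [← hc, mul_zero])
  have hc0 : c ≠ 0 := by
    rintro rfl
    exact hg0 (by rw [← hc, zero_mul])
  have hμfX : mu fX = D.mu := mu_generator_eq_muInvariant D.X hD hfX0 hchar
  refine ⟨hD, ?_⟩
  rw [← hμfX]
  have hle : mu fX ≤ mu g := by rw [← hc, mul_comm]; exact mu_le_mu_mul hfX0 hc0
  exact Nat.le_zero.mp (hle.trans hμg)

/-- **`TowerGapAtTwo W` ON THE ORD-RED ROAD (MEMO-7 (4.3) «T-ord-2 per class», MEMO tier)**: binder `hB7` + PUB/PRINT by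
name {`hmod`, `hGZK`, `h17`, `hGr`, `hCassels`} + RECORD `hr` + KERNEL {`¬ CM`, `GoodOrd W 2`, `HasRationalTwoTorsionX W x`} +
CERT `hμan : AnalyticMuLE W 2 0` ⇒ `X(E/ℚ_∞)` torsion with `μ = 0` for every cyclotomic datum. No layer count.
[cite: GreenbergLNM1716, Thm. 4.1 (p. 102) and p. 170] [cite: Kato2004Asterisque, Thm. 17.4 (1)(2) (p. 273)]
[cite: GreenbergVatsal2000, p. 2, (2)] -/
theorem towerGapAtTwo_ordRed_of_analyticMuLE
    (hB7 : KatoMuPartAtOptimalMemberOfNotSurjectiveTwo)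
    (hmod : nonempty_modularParametrizationData) (hGZK : rank_eq_analyticRank_of_analyticRank_le_one)
    (h17 : ∀ (V : WeierstrassCurve ℚ) [V.IsElliptic] [V.IsGloballyMinimal] [NeZero (V.conductorNorm ℤ)]
      (f : CuspForm (Gamma0 (V.conductorNorm ℤ)) 2), kato_divisibility_allPrimes V 2 (f := f))
    (hGr : Greenberg1999.thm41_charValue_rankZero_anyPrime) (hCassels : bsdRHS_eq_of_isIsogenous)
    (hcm : ¬ W.HasCM) (hr : W.analyticRank = 0) (hgo : GoodOrd W 2) {x : ℚ}
    (hx : HasRationalTwoTorsionX W x) (hμan : AnalyticMuLE W 2 0) : TowerGapAtTwo W :=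
  towerGapAtTwo_of_mainConjectureLowerDivisibilityAtTwoOrd_of_analyticMuLE W hmod (fun f => h17 W f) hgo
    (mainConjectureLowerDivisibilityAtTwoOrd_ordRed W hB7 hmod hGZK h17 hGr hCassels hcm hr hgo hx) hμan

/-- **BOTH typed targets of the seat's brief AT a rank-`0` member of the `E[2]`-reducible good-ordinary block, ORD-RED road**:
`TowerGapAtTwo W ∧ O1.MainConjectureLowerDivisibilityAtTwoOrd W` from the binder, PUB/PRINT by name, the record `hr`,
the kernel legs and the single certificate `μ_an = 0` (compare the α-go door
`O1.towerGapAtTwo_and_mainConjectureLowerDivisibilityAtTwoOrd_of_prop514`: there Greenberg Prop. 5.14 at `2`, here the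
MEMO-7 binder + `μ_an = 0`). [cite: GreenbergLNM1716, Prop. 5.14 (p. 121) and p. 170] [cite: Kato2004Asterisque, Thm. 17.4 (1)(2) (p. 273)] -/
theorem towerGapAtTwo_and_mainConjectureLowerDivisibilityAtTwoOrd_ordRed_of_analyticMuLE
    (hB7 : KatoMuPartAtOptimalMemberOfNotSurjectiveTwo)
    (hmod : nonempty_modularParametrizationData) (hGZK : rank_eq_analyticRank_of_analyticRank_le_one)
    (h17 : ∀ (V : WeierstrassCurve ℚ) [V.IsElliptic] [V.IsGloballyMinimal] [NeZero (V.conductorNorm ℤ)]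
      (f : CuspForm (Gamma0 (V.conductorNorm ℤ)) 2), kato_divisibility_allPrimes V 2 (f := f))
    (hGr : Greenberg1999.thm41_charValue_rankZero_anyPrime) (hCassels : bsdRHS_eq_of_isIsogenous)
    (hcm : ¬ W.HasCM) (hr : W.analyticRank = 0) (hgo : GoodOrd W 2) {x : ℚ}
    (hx : HasRationalTwoTorsionX W x) (hμan : AnalyticMuLE W 2 0) :
    TowerGapAtTwo W ∧ O1.MainConjectureLowerDivisibilityAtTwoOrd W :=
  have hK := mainConjectureLowerDivisibilityAtTwoOrd_ordRed W hB7 hmod hGZK h17 hGr hCassels hcm hr hgo hx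
  ⟨towerGapAtTwo_of_mainConjectureLowerDivisibilityAtTwoOrd_of_analyticMuLE W hmod (fun f => h17 W f) hgo hK hμan, hK⟩

end Summit.BirchSwinnertonDyer.BirchSwinnertonDyer.Theorems.OrdRedAtTwo

end
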